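import Literature.NumberTheory.EllipticCurves.TwoDescentLocalTwo
import HarnessLib

/-!
# `rk E(F₄)` for `E = 480a1`, VII: the dyadic local conditions on the twists `E^{(d)}`, `d ≡ 7 (8)`

For the complete `2`-descent over `ℚ` of the quadratic twists
`E^{(d)} : y² = x (x + 2d)(x - 3d)` (`e₁ = 0`, `e₂ = -2d`, `e₃ = 3d`) of `E = 480a1` with
`d ≡ 7 (mod 8)` (the twists `d = -1, -41, -73` whose ranks over `ℚ` enter
`rk E(F₄) = Σ_d rk E^{(d)}(ℚ)`, Dokchitser–Dokchitser 2011, proof of Thm. 2; see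
`RankNotSumOfLocalInvariantsF4TwistsQ.lean`), this file PROVES the local conditions at `p = 2`
satisfied by the descent pair `δ(P) = (x, x + 2d)` of every rational point `P = (x, y)`, `y ≠ 0`
(`dyadic_conditions_of_mod_eight_eq_seven`):

* `v₂(x) ≡ v₂(x + 2d) (mod 2)`;
* the odd part of `x` is `≡ 1 (mod 4)` (`chi4 x = 0`);
* `chi8 (x + 2d) = chi8 x + v₂(x) (mod 2)`.

These three linear conditions cut the `64` classes of `ℚ₂*/ℚ₂*² × ℚ₂*/ℚ₂*²` down to the `8`
classes of the image of `E^{(d)}(ℚ₂)/2E^{(d)}(ℚ₂)` (`#E(ℚ₂)[2] · 2 = 8`, Silverman AEC X.1,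
proof of Prop. X.1.4); only the containment for RATIONAL points is proved, by the case analysis
on `v = v₂(x)`: `v < 0` (all three factors dominate equally, `v` even), `v = 0`
(`x - 3d ≡ 0 (mod 4)`), `v = 1` (`v₂(x + 2d)` odd `≥ 3`), `v ≥ 2` (`v` odd, `v₂(x + 2d) = 1`),
the residues modulo `8` of the odd parts being computed with the ultrametric rule
`res8 (a + b) = res8 a + 2^k res8 b` (`v₂(b) = v₂(a) + k`) of `TwoDescentLocalTwo.lean` and the
square relation `res8 x · res8 (x + 2d) · res8 (x - 3d) = res8 (y²) = 1`.

## References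

* T. Dokchitser, V. Dokchitser, *A note on the Mordell–Weil rank modulo `n`*, J. Number Theory
  131 (2011) 1833–1839, arXiv:0910.4588, proof of Thm. 2. [DokchitserDokchitser2011RankModN]
* J. H. Silverman, *The Arithmetic of Elliptic Curves*, 2nd ed., GTM 106 (2009), Prop. X.1.4,
  Example X.1.5. [SilvermanAEC2009]
-/

noncomputable section

open scoped Classical

namespace Literature.Barriers.BirchSwinnertonDyer

namespace DokchitserDokchitser2011

open Literature.NumberTheory.EllipticCurves.KramerTwoDescent
open Literature.NumberTheory.EllipticCurves.TwoDescentLocal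

/-! ### Dyadic arithmetic of rationals -/

/-- In `ℤ/2`, a non-zero element is `1`. [folklore] -/
theorem zmod_two_eq_one_of_ne_zero : ∀ b : ZMod 2, b ≠ 0 → b = 1 := by decide

/-- **Two `2`-adic units sum to a non-unit**: if `v₂(a) = v₂(b) = 0` and `a + b ≠ 0` then
`v₂(a + b) ≥ 1`. [folklore] -/
theorem one_le_padicValRat_two_add {a b : ℚ} (ha0 : a ≠ 0) (hb0 : b ≠ 0)
    (ha : padicValRat 2 a = 0) (hb : padicValRat 2 b = 0) (hab : a + b ≠ 0) :
    1 ≤ padicValRat 2 (a + b) := by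
  by_contra hlt
  have hge : 0 ≤ padicValRat 2 (a + b) := by
    have := padicValRat.min_le_padicValRat_add (p := 2) hab
    rw [ha, hb, min_self] at this
    exact this
  have h0 : padicValRat 2 (a + b) = 0 := by omega
  have hra : res 2 a = 1 := zmod_two_eq_one_of_ne_zero _ (res_ne_zero 2 ha0)
  have hrb : res 2 b = 1 := zmod_two_eq_one_of_ne_zero _ (res_ne_zero 2 hb0)
  have hrab : res 2 (a + b) = 1 := zmod_two_eq_one_of_ne_zero _ (res_ne_zero 2 hab)
  rw [res_of_eq_zero 2 ha] at hra
  rw [res_of_eq_zero 2 hb] at hrb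
  rw [res_of_eq_zero 2 h0, Rat.cast_add_of_ne_zero (den_ne_zero_of_nonneg 2 ha.ge)
    (den_ne_zero_of_nonneg 2 hb.ge), hra, hrb] at hrab
  exact absurd hrab (by decide)

/-- `2^k = 0` in `ℤ/8` for `k ≥ 3`. [folklore] -/
theorem two_pow_eq_zero_of_le {k : ℕ} (hk : 3 ≤ k) : (2 : ZMod (2 ^ 3)) ^ k = 0 := by
  obtain ⟨m, rfl⟩ := Nat.exists_eq_add_of_le hk
  rw [pow_add]
  exact mul_eq_zero_of_left (by decide) _

/-- The parity bit of a `2`-adic valuation, odd case. [folklore] -/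
theorem parityBit_two_of_not_even {a : ℚ} (h : ¬ Even (padicValRat 2 a)) : parityBit 2 a = 1 :=
  zmod_two_eq_one_of_ne_zero _ fun h0 => h (parityBit_eq_zero_iff.mp h0)

section Twist

variable {d : ℤ} (hd : d % 8 = 7)
include hd

/-- `d ≡ 7 (mod 8)` is odd. [folklore] -/
theorem not_two_dvd_of_mod_eight : ¬ (2 : ℤ) ∣ d := by omega

/-- `(d : ℤ/8) = 7`. [folklore] -/
theorem intCast_zmod_eight_eq : (d : ZMod (2 ^ 3)) = 7 := by
  have h : ((d % 8 : ℤ) : ZMod (2 ^ 3)) = (d : ZMod (2 ^ 3)) := ZMod.intCast_mod d (2 ^ 3)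
  rw [hd] at h
  exact_mod_cast h.symm

/-- `res8 d = 7`. [folklore] -/
theorem res8_d : res8 (d : ℚ) = 7 := by
  rw [res8_intCast (not_two_dvd_of_mod_eight hd), intCast_zmod_eight_eq hd]

/-- `v₂(d) = 0`. [folklore] -/
theorem padicValRat_d : padicValRat 2 (d : ℚ) = 0 :=
  padicValRat_intCast_eq_zero (by exact_mod_cast not_two_dvd_of_mod_eight hd)

/-- `d ≠ 0` in `ℚ`. [folklore] -/
theorem d_ne_zero : (d : ℚ) ≠ 0 := by
  have : d ≠ 0 := by omega
  exact_mod_cast this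

/-- `v₂(2d) = 1` and `res8 (2d) = 7`. [folklore] -/
theorem two_mul_d : padicValRat 2 (2 * (d : ℚ)) = 1 ∧ res8 (2 * (d : ℚ)) = 7 := by
  have h := d_ne_zero hd
  refine ⟨?_, ?_⟩
  · rw [padicValRat.mul two_ne_zero h, padicValRat_d hd,
      show (2 : ℚ) = ((2 : ℕ) : ℚ) by norm_num, padicValRat.self one_lt_two]; rfl
  · rw [show (2 : ℚ) * d = (2 : ℚ) ^ (1 : ℤ) * d by norm_num, res8_two_zpow_mul 1 h]
    exact res8_d hd

/-- `v₂(3d) = 0` and `res8 (3d) = 5`. [folklore] -/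
theorem three_mul_d : padicValRat 2 (3 * (d : ℚ)) = 0 ∧ res8 (3 * (d : ℚ)) = 5 := by
  have h := d_ne_zero hd
  have h3 : padicValRat 2 (3 : ℚ) = 0 := by
    rw [show (3 : ℚ) = ((3 : ℤ) : ℚ) by norm_num]; exact padicValRat_intCast_eq_zero (by decide)
  refine ⟨by rw [padicValRat.mul three_ne_zero h, h3, padicValRat_d hd, add_zero], ?_⟩
  rw [res8_mul three_ne_zero h, show (3 : ℚ) = ((3 : ℤ) : ℚ) by norm_num,
    res8_intCast (show ¬ (2 : ℤ) ∣ 3 by decide), res8_d hd]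
  decide

/-- `v₂(-3d) = 0` and `res8 (-3d) = 3`. [folklore] -/
theorem neg_three_mul_d : padicValRat 2 (-3 * (d : ℚ)) = 0 ∧ res8 (-3 * (d : ℚ)) = 3 := by
  have h := d_ne_zero hd
  have h3 : padicValRat 2 (-3 : ℚ) = 0 := by
    rw [show (-3 : ℚ) = ((-3 : ℤ) : ℚ) by norm_num]; exact padicValRat_intCast_eq_zero (by decide)
  refine ⟨by rw [padicValRat.mul (by norm_num) h, h3, padicValRat_d hd, add_zero], ?_⟩
  rw [res8_mul (by norm_num) h, show (-3 : ℚ) = ((-3 : ℤ) : ℚ) by norm_num,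
    res8_intCast (show ¬ (2 : ℤ) ∣ -3 by decide), res8_d hd]
  decide

/-- **The dyadic local conditions on `E^{(d)} : y² = x (x + 2d)(x - 3d)`, `d ≡ 7 (mod 8)`.** For
every rational point `(x, y)` with `y ≠ 0`:
`v₂(x) ≡ v₂(x + 2d) (mod 2)`, `chi4 x = 0` (the odd part of `x` is `1 mod 4`), and
`chi8 (x + 2d) = chi8 x + (v₂(x) mod 2)`. (Silverman AEC X.1: the image of the `2`-adic points
in `ℚ₂*/ℚ₂*² × ℚ₂*/ℚ₂*²` has order `8`; these are three of its defining linear conditions,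
verified on rational points.) [cite: SilvermanAEC2009, Prop. X.1.4] -/
theorem dyadic_conditions_of_mod_eight_eq_seven {x y : ℚ} (hy : y ≠ 0)
    (h : y ^ 2 = x * (x + 2 * d) * (x - 3 * d)) :
    parityBit 2 x = parityBit 2 (x + 2 * d) ∧ chi4 x = 0 ∧
      chi8 (x + 2 * d) = chi8 x + parityBit 2 x := by
  -- non-vanishing of the three factors
  have h₀ : x * (x + 2 * d) * (x - 3 * d) ≠ 0 := h ▸ pow_ne_zero 2 hy
  have hx : x ≠ 0 := fun h0 => h₀ (by rw [h0, zero_mul, zero_mul])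
  have hx₂ : x + 2 * d ≠ 0 := fun h0 => h₀ (by rw [h0, mul_zero, zero_mul])
  have hx₃ : x - 3 * d ≠ 0 := fun h0 => h₀ (by rw [h0, mul_zero])
  obtain ⟨hv2d, hr2d⟩ := two_mul_d hd
  obtain ⟨hv3d, hr3d⟩ := three_mul_d hd
  obtain ⟨hvm3d, hrm3d⟩ := neg_three_mul_d hd
  have hvd := padicValRat_d hd
  have h2d0 : (2 : ℚ) * d ≠ 0 := mul_ne_zero two_ne_zero (d_ne_zero hd)
  have h3d0 : (3 : ℚ) * d ≠ 0 := mul_ne_zero three_ne_zero (d_ne_zero hd)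
  have hm3d0 : (-3 : ℚ) * d ≠ 0 := mul_ne_zero (by norm_num) (d_ne_zero hd)
  -- the parity of the valuations and the square relation of the residues
  have hsum : Even (padicValRat 2 x + padicValRat 2 (x + 2 * d) + padicValRat 2 (x - 3 * d)) := by
    have key := congrArg (padicValRat 2) h
    rw [padicValRat.pow, padicValRat.mul (mul_ne_zero hx hx₂) hx₃, padicValRat.mul hx hx₂] at key
    exact ⟨padicValRat 2 y, by omega⟩
  have hsq : res8 x * res8 (x + 2 * d) * res8 (x - 3 * d) = 1 := by
    have key := congrArg res8 h
    rw [res8_sq, res8_mul (mul_ne_zero hx hx₂) hx₃, res8_mul hx hx₂, sq, res8_mul_self hy] at key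
    exact key.symm
  have hrx : res8 x * res8 x = 1 := res8_mul_self hx
  have hrx₂ : res8 (x + 2 * d) * res8 (x + 2 * d) = 1 := res8_mul_self hx₂
  have hrx₃ : res8 (x - 3 * d) * res8 (x - 3 * d) = 1 := res8_mul_self hx₃
  -- rearrangements
  have e₃ : x - 3 * d = x + (-3) * d := by ring
  have e₃' : x - 3 * d = (-3) * d + x := by ring
  have e₂' : x + 2 * d = 2 * d + x := by ring
  set v := padicValRat 2 x with hvdef
  rcases lt_trichotomy v 0 with hneg | hzero | hpos
  · ----------------------------------------------------------------
    -- Case `v < 0`: `v₂(x + 2d) = v₂(x - 3d) = v`, `v` even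
    have d₂ := padicValRat_add_eq_left (p := 2) hx (b := 2 * (d : ℚ))
      (Or.inr (by rw [hv2d, ← hvdef]; omega))
    have d₃ := padicValRat_add_eq_left (p := 2) hx (b := (-3) * (d : ℚ))
      (Or.inr (by rw [hvm3d, ← hvdef]; omega))
    rw [← e₃] at d₃
    rw [← hvdef] at d₂ d₃
    have heven : Even v := by
      rw [d₂.2, d₃.2] at hsum
      obtain ⟨k, hk⟩ := hsum
      exact ⟨k - v, by omega⟩
    have hle : v ≤ -2 := by obtain ⟨k, hk⟩ := heven; omega
    -- residues: `res8 (x + 2d) = res8 x`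
    have r₂ : res8 (x + 2 * d) = res8 x := by
      rw [res8_add_of_eq hx (k := (1 - v).toNat) (by omega) (by rw [hv2d, ← hvdef]; omega),
        two_pow_eq_zero_of_le (by omega), zero_mul, add_zero]
    have hpar₁ : parityBit 2 x = 0 := parityBit_eq_zero_iff.mpr (by rw [← hvdef]; exact heven)
    have hpar₂ : parityBit 2 (x + 2 * d) = 0 :=
      parityBit_eq_zero_iff.mpr (by rw [d₂.2]; exact heven)
    refine ⟨by rw [hpar₁, hpar₂], ?_, by rw [chi8, chi8, r₂, hpar₁, add_zero]⟩
    -- `chi4 x = 0`: the residue of `x` is `1` or `5`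
    rcases (show v = -2 ∨ v ≤ -4 by obtain ⟨k, hk⟩ := heven; omega) with hv2 | hv4
    · have r₃ : res8 (x - 3 * d) = res8 x + 2 ^ 2 * 3 := by
        rw [e₃, res8_add_of_eq hx (k := 2) (by omega) (by rw [hvm3d, ← hvdef, hv2]; norm_num),
          hrm3d]
      rw [r₂, r₃] at hsq
      have key : ∀ r : ZMod (2 ^ 3), r * r = 1 → r * r * (r + 2 ^ 2 * 3) = 1 → chi4Of r = 0 := by
        decide
      exact key _ hrx hsq
    · have r₃ : res8 (x - 3 * d) = res8 x := by
        rw [e₃, res8_add_of_eq hx (k := (-v).toNat) (by omega) (by rw [hvm3d, ← hvdef]; omega),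
          two_pow_eq_zero_of_le (by omega), zero_mul, add_zero]
      rw [r₂, r₃] at hsq
      have key : ∀ r : ZMod (2 ^ 3), r * r = 1 → r * r * r = 1 → chi4Of r = 0 := by decide
      exact key _ hrx hsq
  · ----------------------------------------------------------------
    -- Case `v = 0`: `v₂(x + 2d) = 0`, `res8 (x + 2d) = res8 x + 2·7`; `v₂(x - 3d) ≥ 2` even
    have hv₂ : padicValRat 2 (x + 2 * d) = 0 := by
      have d₂ := padicValRat_add_eq_left (p := 2) hx (b := 2 * (d : ℚ))
        (Or.inr (by rw [hv2d, ← hvdef]; omega))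
      rw [d₂.2, ← hvdef, hzero]
    have r₂ : res8 (x + 2 * d) = res8 x + 2 ^ 1 * 7 := by
      rw [res8_add_of_eq hx (k := 1) le_rfl (by rw [hv2d, ← hvdef, hzero]; norm_num), hr2d]
    have hw1 : 1 ≤ padicValRat 2 (x - 3 * d) := by
      rw [e₃]
      exact one_le_padicValRat_two_add hx hm3d0 (by rw [← hvdef, hzero]) hvm3d (e₃ ▸ hx₃)
    have hweven : Even (padicValRat 2 (x - 3 * d)) := by
      rw [hzero, hv₂, zero_add, zero_add] at hsum; exact hsum
    have hw2 : 2 ≤ padicValRat 2 (x - 3 * d) := by obtain ⟨k, hk⟩ := hweven; omega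
    -- `x = 3d + (x - 3d)`: `res8 x = 5 + 2^w res8 (x - 3d)`
    have rx : res8 x =
        5 + (2 : ZMod (2 ^ 3)) ^ (padicValRat 2 (x - 3 * d)).toNat * res8 (x - 3 * d) := by
      have := res8_add_of_eq (a := 3 * (d : ℚ)) (b := x - 3 * d) h3d0
        (k := (padicValRat 2 (x - 3 * d)).toNat) (by omega) (by rw [hv3d]; omega)
      rw [show (3 : ℚ) * d + (x - 3 * d) = x by ring, hr3d] at this
      exact this
    have hpar₁ : parityBit 2 x = 0 :=
      parityBit_eq_zero_iff.mpr (by rw [← hvdef, hzero]; exact ⟨0, rfl⟩)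
    have hpar₂ : parityBit 2 (x + 2 * d) = 0 :=
      parityBit_eq_zero_iff.mpr (by rw [hv₂]; exact ⟨0, rfl⟩)
    rcases (show padicValRat 2 (x - 3 * d) = 2 ∨ 3 ≤ padicValRat 2 (x - 3 * d) by omega)
      with hw | hw
    · rw [hw, show ((2 : ℤ)).toNat = 2 from rfl] at rx
      have key : ∀ r r₃ : ZMod (2 ^ 3), r₃ * r₃ = 1 → r = 5 + 2 ^ 2 * r₃ →
          chi4Of r = 0 ∧ chi8Of (r + 2 ^ 1 * 7) = chi8Of r + 0 := by decide
      obtain ⟨k1, k2⟩ := key _ _ hrx₃ rx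
      exact ⟨by rw [hpar₁, hpar₂], k1, by rw [chi8, chi8, r₂, hpar₁]; exact k2⟩
    · rw [two_pow_eq_zero_of_le (by omega), zero_mul, add_zero] at rx
      refine ⟨by rw [hpar₁, hpar₂], by rw [chi4, rx]; decide, ?_⟩
      rw [chi8, chi8, r₂, rx, hpar₁]; decide
  · ----------------------------------------------------------------
    rcases (show v = 1 ∨ 2 ≤ v by omega) with hone | htwo
    · -- Case `v = 1`: `v₂(x - 3d) = 0`, `res8 (x - 3d) = 3 + 2 res8 x`; `v₂(x + 2d)` odd `≥ 3`
      have r₃ : res8 (x - 3 * d) = 3 + 2 ^ 1 * res8 x := by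
        rw [e₃', res8_add_of_eq hm3d0 (k := 1) le_rfl (by rw [hvm3d, ← hvdef, hone]; norm_num),
          hrm3d]
      have hv₃ : padicValRat 2 (x - 3 * d) = 0 := by
        have d₃ := padicValRat_add_eq_left (p := 2) hm3d0 (b := x)
          (Or.inr (by rw [hvm3d, ← hvdef, hone]; norm_num))
        rw [← e₃'] at d₃
        rw [d₃.2, hvm3d]
      -- `x + 2d = 2 (x/2 + d)` has valuation `≥ 2`
      have hxh : padicValRat 2 (x / 2) = 0 := by
        rw [padicValRat.div hx two_ne_zero, ← hvdef, hone,
          show (2 : ℚ) = ((2 : ℕ) : ℚ) by norm_num, padicValRat.self one_lt_two]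
        rfl
      have hw2 : 2 ≤ padicValRat 2 (x + 2 * d) := by
        have hsum' : x / 2 + d ≠ 0 := by
          intro h0; apply hx₂; linear_combination (2 : ℚ) * h0
        have h1 := one_le_padicValRat_two_add (div_ne_zero hx two_ne_zero) (d_ne_zero hd) hxh
          hvd hsum'
        have e : x + 2 * d = 2 * (x / 2 + d) := by ring
        rw [e, padicValRat.mul two_ne_zero hsum', show (2 : ℚ) = ((2 : ℕ) : ℚ) by norm_num,
          padicValRat.self one_lt_two]
        push_cast
        omega
      have hwodd : ¬ Even (padicValRat 2 (x + 2 * d)) := by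
        intro hev
        rw [hone, hv₃, add_zero] at hsum
        obtain ⟨k, hk⟩ := hev; obtain ⟨m, hm⟩ := hsum; omega
      have hw3 : 3 ≤ padicValRat 2 (x + 2 * d) := by
        rcases (show padicValRat 2 (x + 2 * d) = 2 ∨ 3 ≤ padicValRat 2 (x + 2 * d) by omega)
          with h2 | h3
        · exact absurd ⟨1, by rw [h2]; rfl⟩ hwodd
        · exact h3
      -- `2d = -x + (x + 2d)`: `7 = 7 res8 x + 2^{w-1} res8 (x + 2d)`
      have hnx : res8 (-x) = 7 * res8 x := by
        rw [show -x = ((-1 : ℤ) : ℚ) * x by push_cast; ring, res8_mul (by norm_num) hx,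
          res8_intCast (show ¬ (2 : ℤ) ∣ -1 by decide),
          show ((-1 : ℤ) : ZMod (2 ^ 3)) = 7 by decide]
      have r2d : (7 : ZMod (2 ^ 3)) =
          7 * res8 x +
            (2 : ZMod (2 ^ 3)) ^ (padicValRat 2 (x + 2 * d) - 1).toNat * res8 (x + 2 * d) := by
        have := res8_add_of_eq (a := -x) (b := x + 2 * d) (neg_ne_zero.mpr hx)
          (k := (padicValRat 2 (x + 2 * d) - 1).toNat) (by omega)
          (by rw [padicValRat.neg, ← hvdef, hone]; omega)
        rw [show -x + (x + 2 * d) = 2 * d by ring, hr2d, hnx] at this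
        exact this
      have hpar₁ : parityBit 2 x = 1 :=
        parityBit_two_of_not_even (by rw [← hvdef, hone]; exact Int.not_even_one)
      have hpar₂ : parityBit 2 (x + 2 * d) = 1 := parityBit_two_of_not_even hwodd
      rw [r₃] at hsq
      rcases (show padicValRat 2 (x + 2 * d) = 3 ∨ 4 ≤ padicValRat 2 (x + 2 * d) by omega)
        with hw | hw
      · rw [hw, show ((3 : ℤ) - 1).toNat = 2 from rfl] at r2d
        have key : ∀ r r₂ : ZMod (2 ^ 3), r * r = 1 → r₂ * r₂ = 1 →
            (7 : ZMod (2 ^ 3)) = 7 * r + 2 ^ 2 * r₂ → r * r₂ * (3 + 2 ^ 1 * r) = 1 →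
            chi4Of r = 0 ∧ chi8Of r₂ = chi8Of r + 1 := by decide
        obtain ⟨k1, k2⟩ := key _ _ hrx hrx₂ r2d hsq
        exact ⟨by rw [hpar₁, hpar₂], k1, by rw [chi8, chi8, hpar₁]; exact k2⟩
      · rw [two_pow_eq_zero_of_le (by omega), zero_mul, add_zero] at r2d
        have key : ∀ r r₂ : ZMod (2 ^ 3), r * r = 1 → r₂ * r₂ = 1 → (7 : ZMod (2 ^ 3)) = 7 * r →
            r * r₂ * (3 + 2 ^ 1 * r) = 1 → chi4Of r = 0 ∧ chi8Of r₂ = chi8Of r + 1 := by decide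
        obtain ⟨k1, k2⟩ := key _ _ hrx hrx₂ r2d hsq
        exact ⟨by rw [hpar₁, hpar₂], k1, by rw [chi8, chi8, hpar₁]; exact k2⟩
    · -- Case `v ≥ 2`: `v₂(x + 2d) = 1`, `v₂(x - 3d) = 0`, `v` odd `≥ 3`
      have d₂ := padicValRat_add_eq_left (p := 2) h2d0 (b := x)
        (Or.inr (by rw [hv2d, ← hvdef]; omega))
      rw [← e₂'] at d₂
      have d₃ := padicValRat_add_eq_left (p := 2) hm3d0 (b := x)
        (Or.inr (by rw [hvm3d, ← hvdef]; omega))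
      rw [← e₃'] at d₃
      have hvodd : ¬ Even v := by
        intro hev
        rw [d₂.2, d₃.2, hv2d, hvm3d] at hsum
        obtain ⟨k, hk⟩ := hev; obtain ⟨m, hm⟩ := hsum; omega
      have hv3 : 3 ≤ v := by
        rcases (show v = 2 ∨ 3 ≤ v by omega) with h2 | h3
        · exact absurd ⟨1, by rw [h2]; rfl⟩ hvodd
        · exact h3
      have r₃ : res8 (x - 3 * d) = 3 := by
        rw [e₃', res8_add_of_eq hm3d0 (k := v.toNat) (by omega) (by rw [hvm3d, ← hvdef]; omega),
          two_pow_eq_zero_of_le (by omega), zero_mul, add_zero, hrm3d]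
      have r₂ : res8 (x + 2 * d) = 7 + (2 : ZMod (2 ^ 3)) ^ (v - 1).toNat * res8 x := by
        rw [e₂', res8_add_of_eq h2d0 (k := (v - 1).toNat) (by omega)
          (by rw [hv2d, ← hvdef]; omega), hr2d]
      have hpar₁ : parityBit 2 x = 1 := parityBit_two_of_not_even (by rw [← hvdef]; exact hvodd)
      have hpar₂ : parityBit 2 (x + 2 * d) = 1 :=
        parityBit_two_of_not_even (by rw [d₂.2, hv2d]; exact Int.not_even_one)
      rw [r₃] at hsq
      rcases (show v = 3 ∨ 4 ≤ v by omega) with hw | hw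
      · rw [hw, show ((3 : ℤ) - 1).toNat = 2 from rfl] at r₂
        have key : ∀ r r₂ : ZMod (2 ^ 3), r * r = 1 → r₂ = 7 + 2 ^ 2 * r → r * r₂ * 3 = 1 →
            chi4Of r = 0 ∧ chi8Of r₂ = chi8Of r + 1 := by decide
        obtain ⟨k1, k2⟩ := key _ _ hrx r₂ hsq
        exact ⟨by rw [hpar₁, hpar₂], k1, by rw [chi8, chi8, hpar₁]; exact k2⟩
      · rw [two_pow_eq_zero_of_le (by omega), zero_mul, add_zero] at r₂
        have key : ∀ r r₂ : ZMod (2 ^ 3), r * r = 1 → r₂ = 7 → r * r₂ * 3 = 1 →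
            chi4Of r = 0 ∧ chi8Of r₂ = chi8Of r + 1 := by decide
        obtain ⟨k1, k2⟩ := key _ _ hrx r₂ hsq
        exact ⟨by rw [hpar₁, hpar₂], k1, by rw [chi8, chi8, hpar₁]; exact k2⟩

end Twist

end DokchitserDokchitser2011

end Literature.Barriers.BirchSwinnertonDyer

end
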